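import Literature.Computability.Complexity.Mod2SosDegree
import HarnessLib

/-!
# Degree-bounded congruences modulo a polynomial system and the matching monomials
# (Braun–Brown-Cohen–Huq–Pokutta–Raghavendra–Roy–Weitz–Zink 2017, §4.2–4.3, Lemma 4.4)

BBCHPRRWZ, *The matching problem has no small symmetric SDP*, Math. Program. 165 (2017), §4.2:
"For polynomials `F` and `G`, we write `F ≅_{(𝒫,d)} G`, or `F` is congruent to `G` from `𝒫` in
degree `d`, if and only if there exist polynomials `{q(p) : p ∈ 𝒫}` such that
`F + Σ_{p ∈ 𝒫} q(p)·p = G` and `max_p deg(q(p)·p) ≤ d`."  This file sets up that calculus for an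
arbitrary finite system `S` (`IsCong S d F G`; reflexive, symmetric, transitive at fixed `d`,
monotone in `d`, compatible with sums, scalars and with multiplication by a polynomial of degree
`k` at the cost `d + k`; `HasDerivationOfDegree S F D` is the special case `0 ≅ F`, the cell's
typed vocabulary of HOME/pnp-psdrank-p2/TARGET.md), and proves, for the matching constraints
`𝒫_n = Mod2.system n`:

* §4.3: the matching monomials `x_M = Π_{e ∈ M} x_e` (`xM`) of partial matchings
  (`IsPartialMatching`: pairwise vertex-disjoint edges of `K_n`);
* `x_e^k ≅_k x_e` (`isCong_X_pow`), a monomial `x^α ≅_{|α|} x_{supp α}` (`isCong_monomial`),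
  and `x_A ≅_{|A|} 0` if `A` is not a partial matching (`isCong_xM_zero`);
* **Lemma 4.4** (`exists_isCong_matchingCombination`): every `F` is congruent in degree `deg F`
  to a linear combination `F'` of matching monomials with `deg F' ≤ deg F`.

## References

* G. Braun et al., *The matching problem has no small symmetric SDP*, Math. Program. 165 (2017)
  643–662, §4.2 (congruences), §4.3, Lemma 4.4 (arXiv:1504.00703, pp. 7–8). [BraunEtAl2016]
-/

noncomputable section

open MvPolynomial Finset

namespace Literature.Computability.Complexity

/-! ### Degree-bounded congruences modulo a system -/

section Cong

variable {ι σ K : Type*} [CommRing K] [Fintype ι]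

/-- **`F ≅_{(S,d)} G`**: `F + Σ_p q_p · S p = G` for some multipliers with `deg (q_p · S p) ≤ d`.
[cite: BraunEtAl2016, §4.2 (p. 7, "F is congruent to G from 𝒫 in degree d")] -/
def IsCong (S : ι → MvPolynomial σ K) (d : ℕ) (F G : MvPolynomial σ K) : Prop :=
  ∃ q : ι → MvPolynomial σ K, (∀ p, (q p * S p).totalDegree ≤ d) ∧ F + ∑ p, q p * S p = G

/-- **Derivations**: `F` is derivable from `S` in degree `D`, `F = Σ_e g_e · S e` with
`deg (g_e · S e) ≤ D` (BBCHPRRWZ: `0 ≅_{(S,D)} F`, "`F ≅ 0`"). [cite: BraunEtAl2016, §4.2 (p. 7)] -/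
def HasDerivationOfDegree (S : ι → MvPolynomial σ K) (F : MvPolynomial σ K) (D : ℕ) : Prop :=
  ∃ g : ι → MvPolynomial σ K, (∀ e, (g e * S e).totalDegree ≤ D) ∧ ∑ e, g e * S e = F

variable {S : ι → MvPolynomial σ K} {d d' : ℕ} {F G H F₁ G₁ F₂ G₂ : MvPolynomial σ K}

/-- `0 ≅_d F` is derivability of `F` in degree `d`. [cite: BraunEtAl2016, §4.2 (p. 7)] -/
theorem isCong_zero_left_iff : IsCong S d 0 F ↔ HasDerivationOfDegree S F d := by
  simp only [IsCong, HasDerivationOfDegree, zero_add]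

/-- `F ≅_d G` iff `G - F` is derivable in degree `d`. [cite: BraunEtAl2016, §4.2 (p. 7)] -/
theorem isCong_iff_hasDerivationOfDegree_sub : IsCong S d F G ↔ HasDerivationOfDegree S (G - F) d := by
  constructor
  · rintro ⟨q, hq, h⟩
    exact ⟨q, hq, by rw [← h]; ring⟩
  · rintro ⟨q, hq, h⟩
    exact ⟨q, hq, by rw [h]; ring⟩

/-- Reflexivity. [cite: BraunEtAl2016, §4.2 (p. 7)] -/
theorem IsCong.refl (F : MvPolynomial σ K) : IsCong S d F F :=
  ⟨0, fun p => by simp, by simp⟩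

/-- Symmetry. [cite: BraunEtAl2016, §4.2 (p. 7)] -/
theorem IsCong.symm (h : IsCong S d F G) : IsCong S d G F := by
  obtain ⟨q, hq, hFG⟩ := h
  refine ⟨-q, fun p => ?_, ?_⟩
  · rw [Pi.neg_apply, neg_mul, totalDegree_neg]; exact hq p
  · simp only [Pi.neg_apply, neg_mul, sum_neg_distrib]
    rw [← hFG]; ring

/-- Transitivity (same degree). [cite: BraunEtAl2016, §4.2 (p. 7)] -/
theorem IsCong.trans (h₁ : IsCong S d F G) (h₂ : IsCong S d G H) : IsCong S d F H := by
  obtain ⟨q₁, hq₁, h₁⟩ := h₁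
  obtain ⟨q₂, hq₂, h₂⟩ := h₂
  refine ⟨q₁ + q₂, fun p => ?_, ?_⟩
  · rw [Pi.add_apply, add_mul]
    exact (totalDegree_add _ _).trans (max_le (hq₁ p) (hq₂ p))
  · simp only [Pi.add_apply, add_mul, sum_add_distrib]
    rw [← h₂, ← h₁]; ring

/-- Monotonicity in the degree. [cite: BraunEtAl2016, §4.2 (p. 7)] -/
theorem IsCong.mono (h : IsCong S d F G) (hd : d ≤ d') : IsCong S d' F G := by
  obtain ⟨q, hq, hFG⟩ := h
  exact ⟨q, fun p => (hq p).trans hd, hFG⟩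

/-- Sums. [cite: BraunEtAl2016, §4.2 (p. 7)] -/
theorem IsCong.add (h₁ : IsCong S d F₁ G₁) (h₂ : IsCong S d F₂ G₂) :
    IsCong S d (F₁ + F₂) (G₁ + G₂) := by
  obtain ⟨q₁, hq₁, h₁⟩ := h₁
  obtain ⟨q₂, hq₂, h₂⟩ := h₂
  refine ⟨q₁ + q₂, fun p => ?_, ?_⟩
  · rw [Pi.add_apply, add_mul]
    exact (totalDegree_add _ _).trans (max_le (hq₁ p) (hq₂ p))
  · simp only [Pi.add_apply, add_mul, sum_add_distrib]
    rw [← h₂, ← h₁]; ring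

/-- Scalars. [cite: BraunEtAl2016, §4.2 (p. 7)] -/
theorem IsCong.smul (h : IsCong S d F G) (a : K) : IsCong S d (a • F) (a • G) := by
  obtain ⟨q, hq, hFG⟩ := h
  refine ⟨a • q, fun p => ?_, ?_⟩
  · rw [Pi.smul_apply, smul_mul_assoc]
    exact (totalDegree_smul_le a _).trans (hq p)
  · simp only [Pi.smul_apply, smul_mul_assoc, ← smul_sum]
    rw [← hFG, smul_add]

/-- Negation. [cite: BraunEtAl2016, §4.2 (p. 7)] -/
theorem IsCong.neg (h : IsCong S d F G) : IsCong S d (-F) (-G) := by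
  have := h.smul (-1)
  simpa using this

/-- Differences. [cite: BraunEtAl2016, §4.2 (p. 7)] -/
theorem IsCong.sub (h₁ : IsCong S d F₁ G₁) (h₂ : IsCong S d F₂ G₂) :
    IsCong S d (F₁ - F₂) (G₁ - G₂) := by
  rw [sub_eq_add_neg, sub_eq_add_neg]
  exact h₁.add h₂.neg

/-- Finite sums. [cite: BraunEtAl2016, §4.2 (p. 7)] -/
theorem IsCong.sum {κ : Type*} {s : Finset κ} {F G : κ → MvPolynomial σ K}
    (h : ∀ k ∈ s, IsCong S d (F k) (G k)) : IsCong S d (∑ k ∈ s, F k) (∑ k ∈ s, G k) := by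
  classical
  induction s using Finset.induction_on with
  | empty => simpa using IsCong.refl (S := S) (d := d) 0
  | insert a s ha ih =>
    rw [sum_insert ha, sum_insert ha]
    exact (h a (mem_insert_self a s)).add (ih fun k hk => h k (mem_insert_of_mem hk))

/-- **Multiplication by a polynomial** of degree `≤ k` costs `k` degrees: `F ≅_d G ⇒ F·H ≅_{d+k} G·H`.
[cite: BraunEtAl2016, §4.2 (p. 7; used throughout §4.3–4.4, e.g. Lemma 4.8)] -/
theorem IsCong.mul_right (h : IsCong S d F G) (H : MvPolynomial σ K) {k : ℕ} (hH : H.totalDegree ≤ k) :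
    IsCong S (d + k) (F * H) (G * H) := by
  obtain ⟨q, hq, hFG⟩ := h
  refine ⟨fun p => q p * H, fun p => ?_, ?_⟩
  · calc (q p * H * S p).totalDegree = (q p * S p * H).totalDegree := by ring_nf
      _ ≤ (q p * S p).totalDegree + H.totalDegree := totalDegree_mul _ _
      _ ≤ d + k := Nat.add_le_add (hq p) hH
  · rw [← hFG, add_mul, sum_mul]
    refine congrArg _ (sum_congr rfl fun p _ => by ring)

/-- Multiplication on the left. [cite: BraunEtAl2016, §4.2 (p. 7)] -/
theorem IsCong.mul_left (h : IsCong S d F G) (H : MvPolynomial σ K) {k : ℕ} (hH : H.totalDegree ≤ k) :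
    IsCong S (d + k) (H * F) (H * G) := by
  rw [mul_comm H F, mul_comm H G]
  exact h.mul_right H hH

/-- A generator is congruent to `0` in its own degree. [cite: BraunEtAl2016, §4.2 (p. 7)] -/
theorem isCong_generator_zero [DecidableEq ι] (p : ι) (hd : (S p).totalDegree ≤ d) :
    IsCong S d (S p) 0 := by
  refine ⟨fun p' => if p' = p then -1 else 0, fun p' => ?_, ?_⟩
  · dsimp only
    by_cases h : p' = p
    · subst h; rw [if_pos rfl, neg_one_mul, totalDegree_neg]; exact hd
    · rw [if_neg h, zero_mul, totalDegree_zero]; exact Nat.zero_le _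
  · dsimp only
    rw [Finset.sum_eq_single p (fun p' _ hp' => by rw [if_neg hp', zero_mul])
      (fun h => absurd (mem_univ p) h), if_pos rfl]
    ring

/-- Congruent polynomials differ by an element of the ideal `⟨S⟩`.
[cite: BraunEtAl2016, §4.2 (p. 7, "F ≡ G: F - G ∈ ⟨𝒫_n⟩")] -/
theorem IsCong.sub_mem_span (h : IsCong S d F G) : G - F ∈ Ideal.span (Set.range S) := by
  obtain ⟨q, -, hFG⟩ := h
  rw [← hFG, add_sub_cancel_left]
  exact Submodule.sum_mem _ fun p _ => Ideal.mul_mem_left _ _ (Ideal.subset_span ⟨p, rfl⟩)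

end Cong

/-! ### Matching monomials and Lemma 4.4 -/

/-- The support of an exponent vector is at most its degree (each exponent on the support is
`≥ 1`). [cite: BraunEtAl2016, Lemma 4.4 (proof, "deg F' ≤ deg F")] -/
theorem card_support_le_degree {σ : Type*} (α : σ →₀ ℕ) : α.support.card ≤ α.sum fun _ k => k := by
  rw [Finsupp.sum, Finset.card_eq_sum_ones]
  exact Finset.sum_le_sum fun e he => Nat.one_le_iff_ne_zero.2 (Finsupp.mem_support_iff.1 he)

namespace Mod2

variable {n : ℕ}

/-- A set of edges of `K_n` is a PARTIAL MATCHING if its edges are pairwise vertex-disjoint.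
[cite: BraunEtAl2016, §4.3 (p. 8, "for a partial matching M")] -/
def IsPartialMatching (M : Finset (KnEdge n)) : Prop :=
  ∀ e ∈ M, ∀ f ∈ M, e ≠ f → ∀ v : Fin n, ¬ (v ∈ (e : Sym2 (Fin n)) ∧ v ∈ (f : Sym2 (Fin n)))

/-- **The matching monomial** `x_M = Π_{e ∈ M} x_e`. [cite: BraunEtAl2016, §4.3 (p. 8, "let x_M := Π_{e ∈ M} x_e")] -/
def xM (M : Finset (KnEdge n)) : MvPolynomial (KnEdge n) ℝ := ∏ e ∈ M, X e

/-- `deg x_M ≤ |M|`. [cite: BraunEtAl2016, §4.3 (p. 8)] -/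
theorem totalDegree_xM_le (M : Finset (KnEdge n)) : (xM M).totalDegree ≤ M.card := by
  refine (totalDegree_finsetProd _ _).trans (le_of_eq ?_)
  calc ∑ e ∈ M, (X e : MvPolynomial (KnEdge n) ℝ).totalDegree = ∑ _e ∈ M, 1 :=
        sum_congr rfl fun e _ => totalDegree_X _
    _ = M.card := by rw [sum_const, smul_eq_mul, mul_one]

/-- `x_{insert e M} = x_e · x_M` for `e ∉ M`. [cite: BraunEtAl2016, §4.3 (p. 8)] -/
theorem xM_insert {e : KnEdge n} {M : Finset (KnEdge n)} (h : e ∉ M) :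
    xM (insert e M) = X e * xM M := by
  rw [xM, xM, prod_insert h]

/-- **`x_e^k ≅_k x_e`** (`k ≥ 1`) from the Boolean axiom `x_e² - x_e`:
`x_e^k - x_e = (Σ_{j ≤ k-2} x_e^j)(x_e² - x_e)`. [cite: BraunEtAl2016, Lemma 4.4 (proof: "from x_e² ≅_2 x_e it follows that x_e^k ≅_k x_e")] -/
theorem isCong_X_pow (e : KnEdge n) {k : ℕ} (hk : 1 ≤ k) :
    IsCong (system n) k (X e ^ k) (X e) := by
  classical
  obtain ⟨j, rfl⟩ : ∃ j, k = j + 1 := ⟨k - 1, by omega⟩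
  -- multiplier `-(Σ_{i<j} x_e^i)` on the Boolean axiom of `e`
  refine ⟨fun ι => if ι = Sum.inl e then -(∑ i ∈ range j, X e ^ i) else 0, fun ι => ?_, ?_⟩
  · dsimp only
    by_cases h : ι = Sum.inl e
    · subst h
      rw [if_pos rfl, system_edge, neg_mul, totalDegree_neg]
      rcases j with _ | j
      · simp
      refine (totalDegree_mul _ _).trans ?_
      have h1 : (∑ i ∈ range (j + 1), (X e : MvPolynomial (KnEdge n) ℝ) ^ i).totalDegree ≤ j := by
        refine (totalDegree_finsetSum _ _).trans (Finset.sup_le fun i hi => ?_)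
        rw [totalDegree_X_pow]
        have := mem_range.1 hi
        omega
      have h2 : ((X e : MvPolynomial (KnEdge n) ℝ) ^ 2 - X e).totalDegree ≤ 2 :=
        (totalDegree_sub _ _).trans (max_le (by rw [totalDegree_X_pow]) (by rw [totalDegree_X]; norm_num))
      omega
    · rw [if_neg h, zero_mul, totalDegree_zero]; exact Nat.zero_le _
  · dsimp only
    rw [Finset.sum_eq_single (Sum.inl e) (fun ι _ hι => by rw [if_neg hι, zero_mul])
      (fun h => absurd (mem_univ _) h), if_pos rfl, system_edge]
    have : (∑ i ∈ range j, (X e : MvPolynomial (KnEdge n) ℝ) ^ i) * (X e ^ 2 - X e) =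
        X e ^ (j + 1) - X e := by
      have h := geom_sum_mul (X e : MvPolynomial (KnEdge n) ℝ) j
      -- `(Σ_{i<j} x^i)(x - 1) = x^j - 1`; multiply by `x`
      calc (∑ i ∈ range j, (X e : MvPolynomial (KnEdge n) ℝ) ^ i) * (X e ^ 2 - X e)
          = ((∑ i ∈ range j, (X e : MvPolynomial (KnEdge n) ℝ) ^ i) * (X e - 1)) * X e := by ring
        _ = (X e ^ j - 1) * X e := by rw [h]
        _ = X e ^ (j + 1) - X e := by ring
    rw [neg_mul, this]
    ring

/-- **A monomial is congruent to the square-free monomial of its support** in its own degree: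
`x^α ≅_{|α|} x_{supp α}`. [cite: BraunEtAl2016, Lemma 4.4 (proof: "hence F ≅_{deg F} Π_{e ∈ A} x_e")] -/
theorem isCong_monomial (α : KnEdge n →₀ ℕ) :
    IsCong (system n) (α.sum fun _ k => k) (monomial α 1) (xM α.support) := by
  classical
  induction α using Finsupp.induction with
  | zero => simpa [xM] using IsCong.refl (S := system n) (d := 0) (1 : MvPolynomial (KnEdge n) ℝ)
  | single_add e k α he hk ih =>
    -- `x^(single e k + α) = x_e^k · x^α`
    have hsplit : (monomial (Finsupp.single e k + α) (1 : ℝ) : MvPolynomial (KnEdge n) ℝ) =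
        X e ^ k * monomial α 1 := by
      rw [X_pow_eq_monomial, monomial_mul, one_mul]
    have hsupp : (Finsupp.single e k + α).support = insert e α.support := by
      rw [Finsupp.support_add_eq, Finsupp.support_single _ hk]
      · rfl
      · rw [Finsupp.support_single _ hk, Finset.disjoint_singleton_left]
        exact he
    have he' : e ∉ α.support := he
    have hdeg : ((Finsupp.single e k + α).sum fun _ k => k) = k + α.sum fun _ k => k := by
      rw [Finsupp.sum_add_index' (fun _ => rfl) (fun _ _ _ => rfl), Finsupp.sum_single_index rfl]
    rw [hsplit, hsupp, xM_insert he', hdeg]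
    have hk1 : 1 ≤ k := Nat.one_le_iff_ne_zero.2 hk
    -- `x_e^k · x^α ≅_{k + |α|} x_e · x^α ≅_{1 + |α|} x_e · x_supp`
    have h1 : IsCong (system n) (k + α.sum fun _ k => k) (X e ^ k * monomial α 1) (X e * monomial α 1) :=
      (isCong_X_pow e hk1).mul_right (monomial α 1) (by rw [totalDegree_monomial _ one_ne_zero])
    have h2 : IsCong (system n) (k + α.sum fun _ k => k) (X e * monomial α 1) (X e * xM α.support) := by
      have := ih.mul_left (X e) (k := 1) (by rw [totalDegree_X])
      rw [add_comm] at this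
      exact this.mono (by omega)
    exact h1.trans h2

/-- **A non-matching square-free monomial is congruent to `0`**: if two distinct edges of `A`
share a vertex then `x_A ≅_{|A|} 0` by the disjointness axiom `x_e x_f`.
[cite: BraunEtAl2016, Lemma 4.4 (proof: "otherwise there are distinct e, f ∈ A with a common vertex, hence x_e x_f ≅_2 0 and F ≅ 0")] -/
theorem isCong_xM_zero {A : Finset (KnEdge n)} (h : ¬ IsPartialMatching A) :
    IsCong (system n) A.card (xM A) 0 := by
  classical
  simp only [IsPartialMatching, not_forall, not_not, exists_prop] at h
  obtain ⟨e, he, f, hf, hne, v, hve, hvf⟩ := h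
  -- `x_A = x_e x_f · x_{A ∖ {e,f}}`
  have hfA : f ∈ A.erase e := mem_erase.2 ⟨hne.symm, hf⟩
  have hA : xM A = (X e * X f) * xM ((A.erase e).erase f) := by
    rw [xM, xM, ← mul_prod_erase A _ he, ← mul_prod_erase _ _ hfA, mul_assoc]
  have hcard : ((A.erase e).erase f).card + 2 = A.card := by
    rw [card_erase_of_mem hfA, card_erase_of_mem he]
    have : 2 ≤ A.card := by
      calc 2 = ({e, f} : Finset (KnEdge n)).card := by rw [card_pair hne]
        _ ≤ A.card := card_le_card (by
            intro x hx; simp only [mem_insert, mem_singleton] at hx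
            rcases hx with rfl | rfl <;> assumption)
    omega
  -- the disjointness generator of the pair `(e, f)` through `v`
  let ι : Idx n := Sum.inr (Sum.inl ⟨(e, f), hne, v, hve, hvf⟩)
  have hgen : IsCong (system n) 2 (X e * X f : MvPolynomial (KnEdge n) ℝ) 0 := by
    have := isCong_generator_zero (S := system n) (d := 2) ι (by
      change (X e * X f : MvPolynomial (KnEdge n) ℝ).totalDegree ≤ 2
      exact (totalDegree_mul _ _).trans (by rw [totalDegree_X, totalDegree_X]))
    exact this
  have := hgen.mul_right (xM ((A.erase e).erase f)) (totalDegree_xM_le _)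
  rw [zero_mul, ← hA] at this
  exact this.mono (by omega)

/-- **BBCHPRRWZ Lemma 4.4.** Every polynomial `F` in the edge variables of `K_n` is congruent
from `𝒫_n` in degree `deg F` to a linear combination `F'` of matching monomials `x_M`
(`M` a partial matching) with `deg F' ≤ deg F`.
[cite: BraunEtAl2016, Lemma 4.4 (p. 8)] -/
theorem exists_isCong_matchingCombination (F : MvPolynomial (KnEdge n) ℝ) :
    ∃ F' : MvPolynomial (KnEdge n) ℝ, F'.totalDegree ≤ F.totalDegree ∧
      IsCong (system n) F.totalDegree F F' ∧
      F' ∈ Submodule.span ℝ {G | ∃ M : Finset (KnEdge n), IsPartialMatching M ∧ G = xM M} := by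
  classical
  -- monomial by monomial
  let F' : MvPolynomial (KnEdge n) ℝ :=
    ∑ α ∈ F.support, if IsPartialMatching α.support then coeff α F • xM α.support else 0
  refine ⟨F', ?_, ?_, ?_⟩
  · refine (totalDegree_finsetSum _ _).trans (Finset.sup_le fun α hα => ?_)
    split_ifs with h
    · refine (totalDegree_smul_le _ _).trans ((totalDegree_xM_le _).trans ?_)
      exact (card_support_le_degree α).trans (le_totalDegree hα)
    · rw [totalDegree_zero]; exact Nat.zero_le _
  · conv_lhs => rw [F.as_sum]
    refine IsCong.sum fun α hα => ?_
    have hdegα : (α.sum fun _ k => k) ≤ F.totalDegree := le_totalDegree hα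
    have hmono : IsCong (system n) F.totalDegree (monomial α (coeff α F)) (coeff α F • xM α.support) := by
      have := (isCong_monomial α).smul (coeff α F)
      rw [smul_monomial, smul_eq_mul, mul_one] at this
      exact this.mono hdegα
    split_ifs with h
    · exact hmono
    · refine hmono.trans ?_
      have := (isCong_xM_zero h).smul (coeff α F)
      rw [smul_zero] at this
      exact this.mono ((card_support_le_degree α).trans hdegα)
  · refine Submodule.sum_mem _ fun α _ => ?_
    split_ifs with h
    · exact Submodule.smul_mem _ _ (Submodule.subset_span ⟨α.support, h, rfl⟩)
    · exact Submodule.zero_mem _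

end Mod2

end Literature.Computability.Complexity
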